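import Literature.Analysis.FluidPDE.CaloricLocalLerayLp
import Literature.Analysis.FluidPDE.CaloricGradientBoxBounds
import Literature.Analysis.FluidPDE.ForwardDSSLocalLerayGradient
import Literature.Analysis.FunctionSpaces.WeakLpSplit
import HarnessLib

/-!
# [BT1] §4, discharged: the caloric extension of weak-`L³` data obeys the linear local Leray bounds

Analysis/FluidPDE proof file (theorems only): the **discharge of the named fact
`Literature.Analysis.FluidPDE.bradshawTsai2017_caloric_localLeray`** (`CaloricLocalLeray.lean`;
Bradshaw–Tsai, *Forward discretely self-similar solutions of the Navier–Stokes equations II*,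
Ann. Henri Poincaré 18 (2017) [BT1], §4, the three heat-flow claims in the proof of Thm 1.2:
"`v₀ ∈ L²_uloc` implies `e^{tΔ}v₀` has uniformly locally finite energy and enstrophy",
"`e^{tΔ}v₀ → v₀` in `L²_loc(ℝ³)` as `t → 0⁺`", "`e^{tΔ}v₀(x)` satisfies the same decay
requirements at spatial infinity as a local Leray solution"), i.e.
`theorem bradshawTsai2017_caloric_localLeray_holds : bradshawTsai2017_caloric_localLeray`.

Proof (Lemarié-Rieusset 2016, proof of Thm 14.1, Step 1, organised through the truncation
`L³_w ⊂ (L¹ ∩ L²) + (L⁴ ∩ L^∞)`): pass to a strongly measurable representative `v₀'` of `v₀`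
(the caloric extension and the weak quasinorm only see the a.e.-class), split
`v₀' = g + h`, `g = v₀'𝟙_{|v₀'|>1} ∈ L¹ ∩ L²`, `h = v₀'𝟙_{|v₀'|≤1} ∈ L⁴`, `|h| ≤ 1`
(`WeakLpSplit.lean`); each piece has a caloric extension with the linear local Leray bounds
(`isCaloricLocalLerayField_heatExtension_of_memLp` of `CaloricLocalLerayLp.lean`, fed with the
enstrophy box bounds `exists_lintegral_box_frobeniusNormSq_le_of_integrable` /
`exists_lintegral_box_frobeniusNormSq_le_of_bound` of `CaloricGradientBoxBounds.lean`), the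
bounds add (`IsCaloricLocalLerayField.add`, `e^{tΔ}v₀ = e^{tΔ}g + e^{tΔ}h` on `t > 0`), and the
datum may be modified on a null set (`IsCaloricLocalLerayField.congr_datum`).

Consequence for the parent fact of this cluster: the existence theorem [BT1] Thm 1.2
(`Literature.Analysis.FluidPDE.bradshawTsai2017_dss_localLeray_existence`) now rests on the single
named fact `bradshawTsai2017_thm_2_4` ([BT1] Thm 2.4 + Lemma 3.4, the time-periodic weak
solution of the Leray system in physical variables):
`bradshawTsai2017_dss_localLeray_existence_of_thm_2_4'`.

## References

* Z. Bradshaw, T.-P. Tsai, Ann. Henri Poincaré 18 (2017) 1095–1119 = arXiv:1510.07504, §4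
  (proof of Thm 1.2) [BradshawTsai2017AHP].
* P. G. Lemarié-Rieusset, *The Navier–Stokes problem in the 21st century*, CRC Press 2016,
  Thm 14.1 (proof, Step 1) [LemarieRieusset2016].
-/

noncomputable section

open MeasureTheory Set Function Filter Topology TopologicalSpace Metric
open scoped NNReal ENNReal

namespace Literature.Analysis.FluidPDE

open UnboundedOperators FunctionSpaces

/-- **`L¹ ∩ L²` data**: the caloric extension of `g ∈ L¹ ∩ L²(ℝ³; ℝ³)` obeys the linear local
Leray bounds (the `Lᵖ` layer with `p = 2` and the global enstrophy bound
`∫₀^∞∫ |∇e^{tΔ}g|² ≤ ½‖g‖₂²`). [cite: LemarieRieusset2016, Theorem 14.1 (proof, Step 1)] -/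
theorem isCaloricLocalLerayField_heatExtension_of_integrable
    {g : EuclideanSpace ℝ (Fin 3) → EuclideanSpace ℝ (Fin 3)} (hg1 : Integrable g)
    (hg2 : MemLp g 2 volume) : IsCaloricLocalLerayField g (heatExtension g) :=
  isCaloricLocalLerayField_heatExtension_of_memLp le_rfl ENNReal.ofNat_ne_top hg2
    fun R _ => exists_lintegral_box_frobeniusNormSq_le_of_integrable hg1 hg2 R

/-- **Bounded `L^q` data**: the caloric extension of `h ∈ L^q(ℝ³; ℝ³)`, `2 ≤ q < ∞`, `|h| ≤ M`,
obeys the linear local Leray bounds (the `Lᵖ` layer with `p = q` and the near/far enstrophy box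
bound). [cite: LemarieRieusset2016, Theorem 14.1 (proof, Step 1)] -/
theorem isCaloricLocalLerayField_heatExtension_of_bound
    {h : EuclideanSpace ℝ (Fin 3) → EuclideanSpace ℝ (Fin 3)} {q : ℝ≥0∞} (hq2 : 2 ≤ q)
    (hq : q ≠ ∞) (hh : MemLp h q volume) {M : ℝ} (hM : ∀ z, ‖h z‖ ≤ M) :
    IsCaloricLocalLerayField h (heatExtension h) :=
  isCaloricLocalLerayField_heatExtension_of_memLp hq2 hq hh
    fun _ hR => exists_lintegral_box_frobeniusNormSq_le_of_bound hh (one_le_two.trans hq2) hM hR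

/-- **[BT1] §4, discharged: the caloric extension of a weak-`L³` datum obeys the linear local
Leray bounds.** For `v₀ ∈ L³_w(ℝ³; ℝ³)`, `e^{tΔ}v₀` is continuous on `(0,∞) × ℝ³`, has uniformly
locally finite energy and enstrophy, attains `v₀` in `L²_loc`, and its local energy decays at
spatial infinity — the conjunction `IsCaloricLocalLerayField v₀ (e^{·Δ}v₀)`. Proof: truncate a
strongly measurable representative at height `1` (`L³_w ⊂ (L¹ ∩ L²) + (L⁴ ∩ L^∞)`) and add the
bounds of the two caloric extensions. [cite: BradshawTsai2017AHP, §4 (proof of Thm 1.2)] -/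
theorem bradshawTsai2017_caloric_localLeray_holds : bradshawTsai2017_caloric_localLeray := by
  intro v₀ hv₀
  -- a strongly measurable representative
  set v₀' := hv₀.1.mk v₀ with hv₀'_def
  have hmeas : StronglyMeasurable v₀' := hv₀.1.stronglyMeasurable_mk
  have hae : v₀ =ᵐ[volume] v₀' := hv₀.1.ae_eq_mk
  have hw : MemWeakLp v₀' 3 volume := hv₀.congr_ae hae
  -- the truncation at height one
  set g := {x | 1 < ‖v₀' x‖}.indicator v₀' with hg_def
  set h := {x | ‖v₀' x‖ ≤ 1}.indicator v₀' with hh_def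
  have h3 : (3 : ℝ≥0∞) ≠ ∞ := ENNReal.ofNat_ne_top
  have hg1 : Integrable g :=
    hw.integrable_indicator_one_lt_norm hmeas h3 (by norm_num)
  have hg2 : MemLp g 2 volume :=
    hw.memLp_indicator_one_lt_norm hmeas h3 two_ne_zero (by norm_num)
  have hh4 : MemLp h 4 volume :=
    hw.memLp_indicator_norm_le_one hmeas (by norm_num) ENNReal.ofNat_ne_top
  have hhM : ∀ z, ‖h z‖ ≤ 1 := norm_indicator_norm_le_one_le v₀'
  have hsum : g + h = v₀' := indicator_one_lt_norm_add_indicator_norm_le_one v₀'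
  have hG := isCaloricLocalLerayField_heatExtension_of_integrable hg1 hg2
  have hH := isCaloricLocalLerayField_heatExtension_of_bound (q := 4) (by norm_num)
    ENNReal.ofNat_ne_top hh4 hhM
  -- `e^{tΔ}v₀ = e^{tΔ}g + e^{tΔ}h` on `t > 0`
  have hU : ∀ t : ℝ, 0 < t → ∀ x,
      heatExtension v₀ t x = heatExtension g t x + heatExtension h t x := by
    intro t ht x
    rw [heatExtension_congr_ae' hae t, ← hsum]
    exact heatExtension_add_apply_of_memLp hg2 hh4 one_le_two (by norm_num) ht x
  have hfield := hG.add hH hh4.1 hU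
  rw [hsum] at hfield
  exact hfield.congr_datum hae

/-- **[BT1] Thm 1.2 from [BT1] Thm 2.4 alone.** With the heat-flow claims of §4 discharged, the
existence of `λ`-DSS local Leray solutions for divergence-free `λ`-DSS data in `L³_w`
(`bradshawTsai2017_dss_localLeray_existence`) follows from the single named fact
`bradshawTsai2017_thm_2_4` (the time-periodic suitable weak solution of the Leray system,
[BT1] Thm 2.4 with Lemma 3.4, in physical variables). [cite: BradshawTsai2017AHP, Thm 1.2 (proof, §4)] -/
theorem bradshawTsai2017_dss_localLeray_existence_of_thm_2_4' (h24 : bradshawTsai2017_thm_2_4) :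
    bradshawTsai2017_dss_localLeray_existence :=
  bradshawTsai2017_dss_localLeray_existence_of_thm_2_4 h24 bradshawTsai2017_caloric_localLeray_holds

end Literature.Analysis.FluidPDE

end
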